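import Literature.MathematicalPhysics.QuantumLattice.HubbardOneBodyKinematicRows
import Literature.MathematicalPhysics.QuantumLattice.HubbardNNNHoppingTorusLimitCorrelator
import HarnessLib

/-!
# The ONE-SPIN diagonal-hop kinematic row: for every torus-limit state, the spin-`σ` diagonal
# (next-nearest-neighbour) hopping density per site lies in `[-8/π², 8/π²]`; hence the `D₄`-averaged
# one-spin diagonal-bond correlator obeys `|v_σ| ≤ 2/π² < 0.2026424`

Family `hubbard` (topic `MathematicalPhysics/QuantumLattice`; companion of `HubbardOneBodyKinematicRows` §3,
whose rows `|K₂(ω)| ≤ 16/π²` are the spin-SUMMED statement). Written for the D-0154 (1)(C) COVERAGE cells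
(`pub/hubbard-obs`, Hg-1201 / La₂CuO₄): the pinned `t'`-PAIR read of a stiffness-ceiling bundle prices its
cross term per LETTER, `T0 = Σ_i B_i |D_i|`, and the two letters whose row coefficients move with `t'` are
the one-spin, `D₄`-averaged diagonal-bond correlators `v25 = ⟨c†_{0↑} c_{x̂+ŷ,↑}⟩_G`, `v116 = ⟨c†_{0↓} c_{x̂+ŷ,↓}⟩_G`
(reader normalisation `K₂ = -4(v25 + v116)`, hubbard-algo-p2 2026-08-28); with the unit box `|v| ≤ 1` the
constant is `B_T' = 8` (hubbard-cov-la214-unc-3's calibrated law `L_le = 8·Δt'·|Δκ_cap|`). This file certifies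
the per-letter range `|v_σ| ≤ 2/π²` for EVERY torus-limit state (no particle-number, sector, ground-state or
symmetry hypothesis), so `B_T' = 8·(2/π²) = 16/π² < 1.6211390` — the same constant as the spin-summed
combination bound (captain hubbard-cov-hg1201-plan-1 RULING «T′-BOX rung (1′)», hubbard-obs STATUS 2026-08-28).

THE ARGUMENT (Lieb–Loss bathtub on ONE spin species at `μ = 0`): on `(ℤ/Lℤ)²`, `L ≥ 3`, the spin-`σ` diagonal hopping
operator `T'_σ` is `dΓ_σ` of the diagonal adjacency matrix (plane-wave levels `4 cos p₁ cos p₂`); for EVERY Fock vector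
`Σ_k min(∓4 cos p₁ cos p₂, 0) ‖φ‖² ≤ ∓Re⟨φ, T'_σ φ⟩` (`FreeKinetic.sum_min_sub_mul_normSq_le`; the particle number does not
enter) and `(1/L²) Σ_k min(∓…, 0) → -8/π²`; the translation average of the local observable
`E'_σ := Σ_s ½((c†_{0σ} c_{j_s σ} + h.c.) + (c†_{-j_s σ} c_{0σ} + h.c.))` (`j_s = e₁ ± e₂`) in a torus vector is `⟨ψ, T'_σ ψ⟩/L²`,
so for a torus limit of unit vectors `|Re ω(E'_σ)| ≤ 8/π²`. For translation-invariant `ω`, `Re ω(E'_σ) = 4 v_σ` with `v_σ` the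
`D₄`-average of `⟨c†_{0σ} c_{x̂+ŷ,σ}⟩` (the eight images of the bond are the four diagonal bonds, each twice;
`ω(c†_0 c_{-δ}) = conj ω(c†_0 c_δ)`) — a docstring dictionary; the typed statements are about `Re ω(E'_σ)` and `Re ω(E'_σ)/4`.

* §0 (private) the quadrature `∫_{[-π,π]²} min(-4t' cos p₁ cos p₂, 0) = -32|t'|`, the corner Riemann sums `→ -8/π²` per spin
  (`diagBandCornerFn`, `sum_min_diagBand_div_sq_eq`, `tendsto_cornerRiemannSum_diagBand`), the decimal `8/π² < 0.8105695`.
* §1 `oneSpinDiagBondObs σ` and its torus image; the translates sum to `hopOp (fermionTorusDiagGraph L) σ`;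
  the translation average is `⟨ψ, T'_σ ψ⟩/L²`.
* §2 the finite-torus one-spin bathtub: `Σ_k min(-t'·4cos p₁ cos p₂, 0)·‖ψ‖² ≤ Re⟨ψ, (-t')•T'_σ ψ⟩`, every `t'`.
* §3 torus limits: `-8/π² ≤ Re ω(E'_σ) ≤ 8/π²`, `|Re ω(E'_σ)| ≤ 8/π² < 0.8105695`, and the LETTER form
  `|Re ω(E'_σ)/4| ≤ 2/π² < 0.2026424 ≤ 2027/10000 ≤ 79/250` (the K2 rung (1′) runbook literals `h♯ = 2027/10000`,
  `h = 79/250`, captain hubbard-cov-hg1201-plan-1 2026-08-28T13:02Z); §4 (appended) the two-point (bond) form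
  `Re ω(E'_σ) = Σ_δ Re ω(c†_{0σ}c_{δσ})` (`twoPointDiag`, Hermiticity of states only) and the same bounds on the four-bond mean.

HONEST FRAMING: one-body kinematics; a range valid for every state of the class, silent about ground states, superconductivity,
`T_c` or any material; the reader's `--ext` use and the node's letter dictionary are the reader's / node typist's business.

## References

* E. H. Lieb, M. Loss, Duke Math. J. 71 (1993) 337, §8, Theorem 8.2. [cite: LiebLoss1993, §8, Theorem 8.2]
* O. Bratteli, D. W. Robinson, *Operator Algebras and Quantum Statistical Mechanics II* (1997), §6.2.4. [cite: BratteliRobinsonII1997, §6.2.4]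
* S. Friedli, Y. Velenik, *Statistical Mechanics of Lattice Systems* (2017), §10.5.2. [cite: FriedliVelenikSMLS2017, §10.5.2]
-/

noncomputable section

namespace Literature.MathematicalPhysics.QuantumLattice

open Matrix Finset HubbardWave0 Literature.Probability.LatticeModels ThermodynamicLimit LangerMattis _root_.Filter
  Literature.MathematicalPhysics.QuantumLattice.RayleighBound
open scoped _root_.Topology ComplexOrder BigOperators

/-! ### §0 Quadrature and plumbing (private copies: the originals are private in `HubbardOneBodyKinematicRows` §3) -/

section Quadrature

open Real Set MeasureTheory

/-- `∫_{-π}^{π} |cos y| dy = 4` (split at `∓π/2`). [folklore] -/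
private theorem integral_abs_cos : ∫ y in (-π)..π, |Real.cos y| = 4 := by
  have hc : ∀ a b : ℝ, IntervalIntegrable (fun y => |Real.cos y|) volume a b := fun a b =>
    (continuous_abs.comp Real.continuous_cos).intervalIntegrable a b
  have hπ := Real.pi_pos
  have h1 : ∫ y in (-π)..(-(π / 2)), |Real.cos y| = 1 := by
    rw [intervalIntegral.integral_congr (g := fun y => -Real.cos y) ?_]
    · rw [intervalIntegral.integral_neg, integral_cos, Real.sin_neg, Real.sin_neg, Real.sin_pi_div_two,
        Real.sin_pi]
      ring
    · intro y hy
      rw [Set.uIcc_of_le (by linarith)] at hy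
      have hcos : Real.cos y ≤ 0 := by
        have h := Real.cos_nonpos_of_pi_div_two_le_of_le (x := -y) (by linarith [hy.2]) (by linarith [hy.1])
        rwa [Real.cos_neg] at h
      exact abs_of_nonpos hcos
  have h2 : ∫ y in (-(π / 2))..(π / 2), |Real.cos y| = 2 := by
    rw [intervalIntegral.integral_congr (g := fun y => Real.cos y) ?_]
    · rw [integral_cos, Real.sin_neg, Real.sin_pi_div_two]
      ring
    · intro y hy
      rw [Set.uIcc_of_le (by linarith)] at hy
      exact abs_of_nonneg (Real.cos_nonneg_of_mem_Icc hy)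
  have h3 : ∫ y in (π / 2)..π, |Real.cos y| = 1 := by
    rw [intervalIntegral.integral_congr (g := fun y => -Real.cos y) ?_]
    · rw [intervalIntegral.integral_neg, integral_cos, Real.sin_pi_div_two, Real.sin_pi]
      ring
    · intro y hy
      rw [Set.uIcc_of_le (by linarith)] at hy
      exact abs_of_nonpos (Real.cos_nonpos_of_pi_div_two_le_of_le hy.1 (by linarith [hy.2]))
  rw [← intervalIntegral.integral_add_adjacent_intervals (hc (-π) (-(π / 2))) (hc (-(π / 2)) π),
    ← intervalIntegral.integral_add_adjacent_intervals (hc (-(π / 2)) (π / 2)) (hc (π / 2) π), h1, h2, h3]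
  norm_num

/-- `min(z, 0) = (z - |z|)/2`. [folklore] -/
private theorem min_zero_eq_half (z : ℝ) : min z 0 = (z - |z|) / 2 := by
  rcases le_total z 0 with h | h
  · rw [min_eq_left h, abs_of_nonpos h]; ring
  · rw [min_eq_right h, abs_of_nonneg h]; ring

/-- `min(-4t'ab, 0) = -2t'ab - 2|t'||a||b|`. [folklore] -/
private theorem min_diag_eq (t' a b : ℝ) :
    min (-t' * (4 * a * b)) 0 = -(2 * t') * (a * b) - 2 * |t'| * (|a| * |b|) := by
  rw [min_zero_eq_half]
  have habs : |-t' * (4 * a * b)| = 4 * |t'| * (|a| * |b|) := by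
    simp only [abs_mul, abs_neg, abs_of_pos (by norm_num : (0 : ℝ) < 4)]
    ring
  rw [habs]
  ring

/-- Inner integral: `∫_{-π}^{π} min(-4t' cos x cos y, 0) dy = -8|t'| |cos x|`. [folklore] -/
private theorem integral_inner_diag (t' x : ℝ) :
    ∫ y in (-π)..π, min (-t' * (4 * Real.cos x * Real.cos y)) 0 = -(8 * |t'|) * |Real.cos x| := by
  simp_rw [min_diag_eq]
  have hf : IntervalIntegrable (fun y => -(2 * t') * (Real.cos x * Real.cos y)) volume (-π) π :=
    (continuous_const.mul (continuous_const.mul Real.continuous_cos)).intervalIntegrable _ _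
  have hg : IntervalIntegrable (fun y => 2 * |t'| * (|Real.cos x| * |Real.cos y|)) volume (-π) π :=
    (continuous_const.mul (continuous_const.mul (continuous_abs.comp Real.continuous_cos))).intervalIntegrable _ _
  rw [intervalIntegral.integral_sub hf hg, intervalIntegral.integral_const_mul,
    intervalIntegral.integral_const_mul, intervalIntegral.integral_const_mul,
    intervalIntegral.integral_const_mul, integral_cos, integral_abs_cos, Real.sin_neg, Real.sin_pi]
  ring

/-- Outer integral: `∫_{-π}^{π} (-8|t'| |cos x|) dx = -32|t'|`. [folklore] -/
private theorem integral_outer_diag (t' : ℝ) :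
    ∫ x in (-π)..π, -(8 * |t'|) * |Real.cos x| = -(32 * |t'|) := by
  rw [intervalIntegral.integral_const_mul, integral_abs_cos]
  ring

/-- The Brillouin zone of `ℤ²` as the preimage of the square. [folklore] -/
private theorem brillouin_two_eq_preimage_square :
    brillouin 2 = (MeasurableEquiv.finTwoArrow : (Fin 2 → ℝ) ≃ᵐ ℝ × ℝ) ⁻¹'
      (Icc (-π) π ×ˢ Icc (-π) π) := by
  ext p
  simp only [brillouin, Set.mem_pi, Set.mem_univ, true_implies, Set.mem_preimage, Set.mem_prod]
  exact ⟨fun h => ⟨h 0, h 1⟩, fun h i => by fin_cases i <;> [exact h.1; exact h.2]⟩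

/-- A Brillouin-zone integral as an integral over the square in `ℝ × ℝ`. [folklore] -/
private theorem integral_brillouin_two_eq_integral_square (g : ℝ × ℝ → ℝ) :
    ∫ p in brillouin 2, g (p 0, p 1) = ∫ q in Icc (-π) π ×ˢ Icc (-π) π, g q := by
  have h := (volume_preserving_finTwoArrow ℝ).setIntegral_preimage_emb
    (MeasurableEquiv.finTwoArrow : (Fin 2 → ℝ) ≃ᵐ ℝ × ℝ).measurableEmbedding g
    (Icc (-π) π ×ˢ Icc (-π) π)
  rw [← brillouin_two_eq_preimage_square] at h
  exact h

/-- Fubini on the square for a continuous integrand. [folklore] -/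
private theorem integral_square_eq_iterated {g : ℝ × ℝ → ℝ} (hg : Continuous g) :
    ∫ q in Icc (-π) π ×ˢ Icc (-π) π, g q = ∫ x in (-π)..π, ∫ y in (-π)..π, g (x, y) := by
  have hππ : -π ≤ π := by linarith [Real.pi_pos]
  rw [Measure.volume_eq_prod, setIntegral_prod g
      (hg.continuousOn.integrableOn_compact (isCompact_Icc.prod isCompact_Icc)),
    intervalIntegral.integral_of_le hππ, ← integral_Icc_eq_integral_Ioc]
  refine setIntegral_congr_fun measurableSet_Icc fun x _ => ?_
  rw [intervalIntegral.integral_of_le hππ, ← integral_Icc_eq_integral_Ioc]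

/-- **`∫_{[-π,π]²} min(-4t' cos p₁ cos p₂, 0) dp = -32|t'|`.** [folklore] -/
private theorem integral_brillouin_two_min_diagBand (t' : ℝ) :
    ∫ p in brillouin 2, min (-t' * (4 * Real.cos (p 0) * Real.cos (p 1))) 0 = -(32 * |t'|) := by
  have h := integral_brillouin_two_eq_integral_square
    (fun q : ℝ × ℝ => min (-t' * (4 * Real.cos q.1 * Real.cos q.2)) 0)
  dsimp only at h
  rw [h, integral_square_eq_iterated (by fun_prop)]
  dsimp only
  simp_rw [integral_inner_diag]
  exact integral_outer_diag t'

/-- `8/π² < 0.8105695` (from `π > 3.14159265358979323846`, Mathlib `Real.pi_gt_d20`). [folklore] -/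
private theorem eight_div_pi_sq_lt_decimal : 8 / Real.pi ^ 2 < (0.8105695 : ℝ) := by
  have hπ : (3.14159265358979323846 : ℝ) < Real.pi := Real.pi_gt_d20
  have hpos : (0 : ℝ) < Real.pi ^ 2 := by positivity
  have hsq : (9.869604401 : ℝ) < Real.pi ^ 2 := by nlinarith
  rw [div_lt_iff₀ hpos]
  nlinarith

end Quadrature


/-! ### §0b The corner Riemann sums of the one-spin diagonal Fermi sea -/

/-- The one-spin diagonal Fermi-sea integrand at the grid corners, sign `s`: `G_s(p) = min(-s·4 cos p₀ cos p₁, 0)`.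
[folklore] -/
def diagBandCornerFn (s : ℝ) : (Fin 2 → ℝ) → ℝ := fun p => min (-s * (4 * Real.cos (p 0) * Real.cos (p 1))) 0

/-- `G_s` is continuous. [folklore] -/
private theorem continuous_diagBandCornerFn (s : ℝ) : Continuous (diagBandCornerFn s) := by
  unfold diagBandCornerFn
  fun_prop

/-- The momentum sum of `G_s` on the torus of side `L` IS the corner Riemann sum (the shift `2πk/L = c_k + π` flips
both cosines, leaving the product unchanged): `(Σ_k G_s(2πk/L)) / L² = (2π)⁻² · cornerRiemannSum G_s L`.
[cite: FriedliVelenikSMLS2017, §10.5.2] -/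
theorem sum_min_diagBand_div_sq_eq (s : ℝ) {L : ℕ} [NeZero L] :
    (∑ k : TorusSite 2 L,
        min (-s * (4 * Real.cos (latticeMomentum L k 0) * Real.cos (latticeMomentum L k 1))) 0) / ((L : ℕ) : ℝ) ^ 2 =
      ((2 * Real.pi) ^ 2)⁻¹ * cornerRiemannSum (diagBandCornerFn s) L := by
  have hsum : ∑ k : TorusSite 2 L,
      min (-s * (4 * Real.cos (latticeMomentum L k 0) * Real.cos (latticeMomentum L k 1))) 0 =
      ∑ z : TorusSite 2 L, diagBandCornerFn s (cellCorner z) := by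
    refine Finset.sum_congr rfl fun k _ => ?_
    simp only [diagBandCornerFn, latticeMomentum_eq_cellCorner_add, Pi.add_apply, Real.cos_add_pi]
    congr 1
    ring
  rw [hsum, HartreeFock.sum_cellCorner_div_eq]

/-- The corner Riemann sums of the one-spin diagonal Fermi sea converge: for `|s| = 1`,
`(2π)⁻² · cornerRiemannSum G_s (Ls j) → (2π)⁻²·(-32) = -8/π²` along any `Ls → ∞`. [cite: FriedliVelenikSMLS2017, §10.5.2] -/
theorem tendsto_cornerRiemannSum_diagBand (s : ℝ) (hs : |s| = 1) {Ls : ℕ → ℕ} (hLs : Tendsto Ls atTop atTop) :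
    Tendsto (fun j => ((2 * Real.pi) ^ 2)⁻¹ * cornerRiemannSum (diagBandCornerFn s) (Ls j))
      atTop (𝓝 (-(8 / Real.pi ^ 2))) := by
  have hval : ((2 * Real.pi) ^ 2)⁻¹ * ∫ p in brillouin 2, diagBandCornerFn s p = -(8 / Real.pi ^ 2) := by
    unfold diagBandCornerFn
    rw [integral_brillouin_two_min_diagBand, hs]
    have hπ : Real.pi ≠ 0 := Real.pi_ne_zero
    field_simp
    ring
  rw [← hval]
  exact ((tendsto_cornerRiemannSum (continuous_diagBandCornerFn s).continuousOn).comp hLs).const_mul _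


/-! ### §1 The one-spin diagonal-bond observable, its torus image and its translation average -/

section OneSpinObs

/-- **The one-spin diagonal-bond observable at the origin**, in `𝔄_{[-1,1]²}`:
`E'_σ = Σ_s ½·((c†_{0σ} c_{j_s σ} + c†_{j_s σ} c_{0σ}) + (c†_{-j_s σ} c_{0σ} + c†_{0σ} c_{-j_s σ}))`, `j_s = e₁ ± e₂` —
the spin-`σ` summand of the diagonal hopping interaction's mean-energy observable at `t' = -1`
(`diagHoppingFermionInteraction_meanEnergyObs`). For a translation-invariant state, `Re ω(E'_σ) = 4 v_σ` with `v_σ`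
the `D₄`-averaged one-spin diagonal-bond correlator `⟨c†_{0σ} c_{x̂+ŷ,σ}⟩_G` (the coverage readers' letters
`v25` (`σ = ↑`) / `v116` (`σ = ↓`), normalisation `K₂ = -4(v25 + v116)`). [cite: BratteliRobinsonII1997, §6.2.4] -/
def oneSpinDiagBondObs (σ : Fin 2) : FermionOp (thicken ({0} : Finset (Site 2)) 1) :=
  ∑ s : Fin 2,
    ((2 : ℂ)⁻¹ • fermionEmbed (PolySite.incl (pair_diagVec_subset_thicken_one s))
        ((cAt (0 : Site 2) (mem_insert_self _ _) σ)ᴴ *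
            cAt ((0 : Site 2) + diagVec s) (mem_insert_of_mem (mem_singleton_self _)) σ +
          (cAt ((0 : Site 2) + diagVec s) (mem_insert_of_mem (mem_singleton_self _)) σ)ᴴ *
            cAt (0 : Site 2) (mem_insert_self _ _) σ) +
      (2 : ℂ)⁻¹ • fermionEmbed (PolySite.incl (pair_neg_diagVec_subset_thicken_one s))
        ((cAt (-diagVec s) (mem_insert_self _ _) σ)ᴴ *
            cAt (-diagVec s + diagVec s) (mem_insert_of_mem (mem_singleton_self _)) σ +
          (cAt (-diagVec s + diagVec s) (mem_insert_of_mem (mem_singleton_self _)) σ)ᴴ *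
            cAt (-diagVec s) (mem_insert_self _ _) σ))

variable {L : ℕ} [NeZero L]

/-- **`E'_σ` in the torus**: for `x ↦ x mod L` injective on `[-1,1]²`, the second quantisation `Γ(ι)` maps
`E'_σ` to `Σ_s ½·((c†_0 c_{j_s} + c†_{j_s} c_0) + (c†_{-j_s} c_0 + c†_0 c_{-j_s}))` (spin `σ`, torus sites).
[cite: BratteliRobinsonII1997, §6.2.4] -/
theorem fermionEmbed_toTorusEmb_oneSpinDiagBondObs (σ : Fin 2) (hT : Set.InjOn (Torus.proj (d := 2) L)
      ↑(thicken ({0} : Finset (Site 2)) 1)) :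
    fermionEmbed (PolySite.toTorusEmb L hT) (oneSpinDiagBondObs σ) =
      ∑ s : Fin 2, (2 : ℂ)⁻¹ •
        ((creation (orb (FermionTorus.ofTorusSite (0 : TorusSite 2 L)) σ) *
            annihilation (orb (FermionTorus.ofTorusSite (torusDiagJump L s)) σ) +
          creation (orb (FermionTorus.ofTorusSite (torusDiagJump L s)) σ) *
            annihilation (orb (FermionTorus.ofTorusSite (0 : TorusSite 2 L)) σ)) +
        (creation (orb (FermionTorus.ofTorusSite (-torusDiagJump L s)) σ) *
            annihilation (orb (FermionTorus.ofTorusSite (0 : TorusSite 2 L)) σ) +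
          creation (orb (FermionTorus.ofTorusSite (0 : TorusSite 2 L)) σ) *
            annihilation (orb (FermionTorus.ofTorusSite (-torusDiagJump L s)) σ))) := by
  have hproj0 : Torus.proj L (0 : Site 2) = 0 := by funext j; simp [Torus.proj]
  have hc : ∀ {X : Finset (Site 2)} (hX : X ⊆ thicken ({0} : Finset (Site 2)) 1) (x : Site 2) (hx : x ∈ X)
      (σ : Fin 2),
      fermionEmbed ((PolySite.incl hX).trans (PolySite.toTorusEmb L hT)) (cAt x hx σ) =
        annihilation (orb (FermionTorus.ofTorusSite (Torus.proj L x)) σ) := by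
    intro X hX x hx σ
    rw [cAt, fermionEmbed_annihilation]
    rfl
  have hcd : ∀ {X : Finset (Site 2)} (hX : X ⊆ thicken ({0} : Finset (Site 2)) 1) (x : Site 2) (hx : x ∈ X)
      (σ : Fin 2),
      fermionEmbed ((PolySite.incl hX).trans (PolySite.toTorusEmb L hT)) ((cAt x hx σ)ᴴ) =
        creation (orb (FermionTorus.ofTorusSite (Torus.proj L x)) σ) := by
    intro X hX x hx σ
    rw [cAt, annihilation_conjTranspose, fermionEmbed_creation]
    rfl
  rw [oneSpinDiagBondObs, fermionEmbed_sum]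
  refine Finset.sum_congr rfl fun s _ => ?_
  rw [fermionEmbed_add, fermionEmbed_smul, fermionEmbed_smul, fermionEmbed_fermionEmbed, fermionEmbed_fermionEmbed,
    ← smul_add]
  congr 1
  rw [fermionEmbed_add, fermionEmbed_add, fermionEmbed_mul, fermionEmbed_mul, fermionEmbed_mul, fermionEmbed_mul,
    hc, hc, hc, hc, hcd, hcd, hcd, hcd, zero_add, neg_add_cancel, hproj0, proj_diagVec, proj_neg_diagVec]

/-- **The one-spin diagonal hopping operator of the torus as a bond sum** (`L ≥ 3`):
`hopOp (fermionTorusDiagGraph L) σ = Σ_v Σ_s (c†_{vσ} c_{v+j_s,σ} + c†_{vσ} c_{v-j_s,σ})` (the four diagonal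
neighbours of `v` are `v ± j_s`, `sum_ite_torusDiagGraph_adj`). [cite: FriedliVelenikSMLS2017, §10.5.2] -/
theorem hopOp_fermionTorusDiagGraph_eq (σ : Fin 2) (hL : 3 ≤ L) :
    hopOp (fermionTorusDiagGraph L) σ =
      ∑ v : TorusSite 2 L, ∑ s : Fin 2,
        (creation (orb (FermionTorus.ofTorusSite v) σ) *
            annihilation (orb (FermionTorus.ofTorusSite (v + torusDiagJump L s)) σ) +
          creation (orb (FermionTorus.ofTorusSite v) σ) *
            annihilation (orb (FermionTorus.ofTorusSite (v - torusDiagJump L s)) σ)) := by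
  set o : TorusSite 2 L → FermionTorus 2 L := FermionTorus.ofTorusSite with ho
  rw [hopOp]
  rw [← Fintype.sum_equiv FermionTorus.equivTorusSite.symm
    (fun v : TorusSite 2 L => ∑ s : Fin 2,
      (creation (orb (o v) σ) * annihilation (orb (o (v + torusDiagJump L s)) σ) +
        creation (orb (o v) σ) * annihilation (orb (o (v - torusDiagJump L s)) σ))) _ (fun v => ?_)]
  rw [← Fintype.sum_equiv FermionTorus.equivTorusSite.symm
    (fun w : TorusSite 2 L =>
      if (fermionTorusDiagGraph L).Adj (FermionTorus.equivTorusSite.symm v) (o w) then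
        creation (orb (FermionTorus.equivTorusSite.symm v) σ) * annihilation (orb (o w) σ) else 0)
    _ (fun w => rfl)]
  have hv : (FermionTorus.equivTorusSite.symm v : FermionTorus 2 L) = o v := rfl
  simp_rw [hv]
  have hadj : ∀ w : TorusSite 2 L, (fermionTorusDiagGraph L).Adj (o v) (o w) ↔ (torusDiagGraph L).Adj v w := by
    intro w; rw [fermionTorusDiagGraph_adj, ho, FermionTorus.toTorusSite_ofTorusSite, FermionTorus.toTorusSite_ofTorusSite]
  have hite : ∀ w : TorusSite 2 L,
      (if (fermionTorusDiagGraph L).Adj (o v) (o w) then creation (orb (o v) σ) * annihilation (orb (o w) σ) else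
        (0 : Matrix (Finset (Orb (FermionTorus 2 L))) (Finset (Orb (FermionTorus 2 L))) ℂ)) =
        if (torusDiagGraph L).Adj v w then creation (orb (o v) σ) * annihilation (orb (o w) σ) else 0 := by
    intro w
    by_cases h : (torusDiagGraph L).Adj v w
    · rw [if_pos h, if_pos ((hadj _).2 h)]
    · rw [if_neg h, if_neg (fun h' => h ((hadj _).1 h'))]
  simp_rw [hite]
  rw [sum_ite_torusDiagGraph_adj hL v]

/-- **The translates of `Γ(ι) E'_σ` sum to the one-spin diagonal hopping operator of the torus.** For `L ≥ 3`:
`Σ_{v ∈ (ℤ/Lℤ)²} T_v (Γ(ι) E'_σ) T_v⁻¹ = hopOp (fermionTorusDiagGraph L) σ` (every diagonal bond of the torus is a bond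
through `v` for exactly its two endpoints, each with weight `½`). [cite: BratteliRobinsonII1997, §6.2.4] -/
theorem sum_relabel_translate_oneSpinDiagBondObs (σ : Fin 2) (hL : 3 ≤ L) :
    ∑ v : TorusSite 2 L, relabel (Orb.translate v)
        (fermionEmbed (PolySite.toTorusEmb L (injOn_proj_thicken_one hL)) (oneSpinDiagBondObs σ)) =
      hopOp (fermionTorusDiagGraph L) σ := by
  set o : TorusSite 2 L → FermionTorus 2 L := FermionTorus.ofTorusSite with ho
  set cd : TorusSite 2 L → Fin 2 → Matrix (Finset (Orb (FermionTorus 2 L))) (Finset (Orb (FermionTorus 2 L))) ℂ :=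
    fun x σ => creation (orb (o x) σ) with hcd
  set c : TorusSite 2 L → Fin 2 → Matrix (Finset (Orb (FermionTorus 2 L))) (Finset (Orb (FermionTorus 2 L))) ℂ :=
    fun x σ => annihilation (orb (o x) σ) with hc
  have hcomm : ∀ (w : TorusSite 2 L) (s : Fin 2), torusDiagJump L s + w = w + torusDiagJump L s :=
    fun w s => add_comm _ _
  have htrans : ∀ v : TorusSite 2 L, relabel (Orb.translate v)
      (fermionEmbed (PolySite.toTorusEmb L (injOn_proj_thicken_one hL)) (oneSpinDiagBondObs σ)) =
      ∑ s : Fin 2, (2 : ℂ)⁻¹ •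
        ((cd v σ * c (v + torusDiagJump L s) σ + cd (v + torusDiagJump L s) σ * c v σ) +
          (cd (v - torusDiagJump L s) σ * c v σ + cd v σ * c (v - torusDiagJump L s) σ)) := by
    intro v
    rw [fermionEmbed_toTorusEmb_oneSpinDiagBondObs σ (injOn_proj_thicken_one hL), relabel_sum]
    simp only [relabel_smul, relabel_add, relabel_mul, relabel_creation, relabel_annihilation,
      Orb.translate_orb, zero_add, neg_add_eq_sub, hcomm]
    rfl
  have hH : hopOp (fermionTorusDiagGraph L) σ =
      ∑ v : TorusSite 2 L, ∑ s : Fin 2, (cd v σ * c (v + torusDiagJump L s) σ + cd v σ * c (v - torusDiagJump L s) σ) :=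
    hopOp_fermionTorusDiagGraph_eq σ hL
  simp_rw [htrans]
  rw [Finset.sum_comm, hH]
  conv_rhs => rw [Finset.sum_comm]
  refine Finset.sum_congr rfl fun s _ => ?_
  have hshift1 : ∑ v : TorusSite 2 L, (2 : ℂ)⁻¹ • (cd (v + torusDiagJump L s) σ * c v σ) =
      ∑ v : TorusSite 2 L, (2 : ℂ)⁻¹ • (cd v σ * c (v - torusDiagJump L s) σ) :=
    (TorusSite.sum_sub_shift (torusDiagJump L s)
      (fun a b => (2 : ℂ)⁻¹ • (cd a σ * c b σ))).symm
  have hshift2 : ∑ v : TorusSite 2 L, (2 : ℂ)⁻¹ • (cd (v - torusDiagJump L s) σ * c v σ) =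
      ∑ v : TorusSite 2 L, (2 : ℂ)⁻¹ • (cd v σ * c (v + torusDiagJump L s) σ) :=
    TorusSite.sum_sub_shift (torusDiagJump L s)
      (fun a b => (2 : ℂ)⁻¹ • (cd b σ * c a σ))
  simp only [smul_add, Finset.sum_add_distrib]
  rw [hshift1, hshift2]
  have ha : (2 : ℂ)⁻¹ + (2 : ℂ)⁻¹ = 1 := by norm_num
  simp only [← Finset.smul_sum]
  conv_rhs => rw [← one_smul ℂ (∑ v : TorusSite 2 L, cd v σ * c (v + torusDiagJump L s) σ),
    ← one_smul ℂ (∑ v : TorusSite 2 L, cd v σ * c (v - torusDiagJump L s) σ), ← ha, add_smul, add_smul]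
  abel

/-- **The averaged expectation of `E'_σ` is the one-spin diagonal hopping energy per site**: for `L ≥ 3` and a
torus vector `ψ`, `torusAvgExpect L [-1,1]² E'_σ ψ = ⟨ψ, T'_σ ψ⟩ / L²`, `T'_σ = hopOp (fermionTorusDiagGraph L) σ`.
[cite: BratteliRobinsonII1997, §6.2.4] -/
theorem torusAvgExpect_oneSpinDiagBondObs (σ : Fin 2) {L : ℕ} (hL : 3 ≤ L)
    (ψ : Fock (Orb (FermionTorus 2 L))) :
    torusAvgExpect L (thicken ({0} : Finset (Site 2)) 1) (oneSpinDiagBondObs σ) ψ =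
      expect (hopOp (fermionTorusDiagGraph L) σ) ψ / ((L : ℂ) ^ 2) := by
  haveI : NeZero L := ⟨by omega⟩
  have hT := injOn_proj_thicken_one (d := 2) hL
  have hcard : Fintype.card (TorusSite 2 L) = L ^ 2 := by simp [ZMod.card, Fintype.card_fin]
  rw [torusAvgExpect_eq, torusAvgExpectAt_of_injOn L hT, hcard, Nat.cast_pow, div_eq_inv_mul]
  congr 1
  have hstep : ∀ v : TorusSite 2 L,
      expect (fermionEmbed (PolySite.toTorusEmb L hT) (oneSpinDiagBondObs σ)) ((fockTranslate v).val *ᵥ ψ) =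
        expect (relabel (Orb.translate (-v))
          (fermionEmbed (PolySite.toTorusEmb L hT) (oneSpinDiagBondObs σ))) ψ := by
    intro v
    rw [expect_fockRelabel_mulVec, ← Equiv.Perm.inv_def, ← Orb.translate_neg]
  simp_rw [hstep]
  rw [Fintype.sum_equiv (Equiv.neg (TorusSite 2 L))
      (fun v => expect (relabel (Orb.translate (-v))
        (fermionEmbed (PolySite.toTorusEmb L hT) (oneSpinDiagBondObs σ))) ψ)
      (fun v => expect (relabel (Orb.translate v)
        (fermionEmbed (PolySite.toTorusEmb L hT) (oneSpinDiagBondObs σ))) ψ)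
      (fun v => rfl)]
  have hsum : ∀ (s : Finset (TorusSite 2 L))
      (f : TorusSite 2 L → Matrix (Finset (Orb (FermionTorus 2 L))) (Finset (Orb (FermionTorus 2 L))) ℂ),
      ∑ v ∈ s, expect (f v) ψ = expect (∑ v ∈ s, f v) ψ := by
    intro s f
    rw [expect, Matrix.sum_mulVec, dotProduct_sum]
    rfl
  rw [hsum, sum_relabel_translate_oneSpinDiagBondObs (L := L) σ hL]

end OneSpinObs

/-! ### §2 The finite-torus one-spin bathtub at chemical potential `0` (no particle number enters) -/

section FiniteTorus

variable {L : ℕ} [NeZero L]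

omit [NeZero L] in
/-- `dΓ_σ(A_{0,t'}) = (-t') · T'_σ`: the second quantisation of the `t = 0` `t–t'` hopping matrix in species `σ`
is `-t'` times the one-spin diagonal hopping operator. [cite: LiebLoss1993, §8 eq. (8.1)] -/
theorem dGammaSpin_ttHopMatrix_zero (σ : Fin 2) (t' : ℝ) :
    dGammaSpin σ (TTPrimeFree.ttHopMatrix L 0 t') = ((-t' : ℝ) : ℂ) • hopOp (fermionTorusDiagGraph L) σ := by
  rw [TTPrimeFree.ttHopMatrix, dGammaSpin_add, FreeKinetic.dGammaSpin_hopMatrix, FreeKinetic.dGammaSpin_hopMatrix,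
    neg_zero, Complex.ofReal_zero, zero_smul, zero_add]

/-- **One-spin bathtub on the torus, momentum form** (`L ≥ 3`): for every `t'`, every spin `σ` and every Fock
vector `ψ` (any particle numbers), `(Σ_k min(-t'·4 cos p₁ cos p₂, 0)) ‖ψ‖² ≤ Re⟨ψ, (-t')·T'_σ ψ⟩` — the sum of the
negative plane-wave levels of the spin-`σ` diagonal band bounds its second quantisation
(`FreeKinetic.sum_min_sub_mul_normSq_le` at `μ = 0`). [cite: LiebLoss1993, §8, Theorem 8.2] -/
theorem sum_min_diagBand_mul_normSq_le_re_oneSpin (hL : 3 ≤ L) (t' : ℝ) (σ : Fin 2)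
    (ψ : Fock (Orb (FermionTorus 2 L))) :
    (∑ k : TorusSite 2 L,
        min (-t' * (4 * Real.cos (latticeMomentum L k 0) * Real.cos (latticeMomentum L k 1))) 0) * normSq ψ ≤
      (star ψ ⬝ᵥ ((((-t' : ℝ) : ℂ) • hopOp (fermionTorusDiagGraph L) σ) *ᵥ ψ)).re := by
  have h : (∑ i, min ((TTPrimeFree.isHermitian_ttHopMatrix (L := L) 0 t').eigenvalues i - 0) 0) * normSq ψ +
      0 * (star ψ ⬝ᵥ ((∑ x : FermionTorus 2 L, numberOp x σ) *ᵥ ψ)).re ≤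
        (star ψ ⬝ᵥ (dGammaSpin σ (TTPrimeFree.ttHopMatrix L 0 t') *ᵥ ψ)).re := by
    convert FreeKinetic.sum_min_sub_mul_normSq_le (σ := σ) (TTPrimeFree.isHermitian_ttHopMatrix (L := L) 0 t') 0 ψ
      using 10
  rw [TTPrimeFree.sum_eigenvalues_ttHopMatrix hL 0 t' (fun x => min (x - 0) 0)] at h
  rw [zero_mul, add_zero, dGammaSpin_ttHopMatrix_zero] at h
  have hsum : ∑ k : TorusSite 2 L, min (TTPrimeFree.ttBand L 0 t' k - 0) 0 =
      ∑ k : TorusSite 2 L, min (-t' * (4 * Real.cos (latticeMomentum L k 0) * Real.cos (latticeMomentum L k 1))) 0 := by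
    refine Finset.sum_congr rfl fun k _ => ?_
    rw [sub_zero, TTPrimeFree.ttBand]
    congr 1
    ring
  rw [hsum] at h
  exact h

/-- **Two-sided form on unit vectors**: for `L ≥ 3`, unit `ψ`, every spin `σ`:
`Σ_k min(4 cos p₁ cos p₂, 0) ≤ Re⟨ψ, T'_σ ψ⟩ ≤ -Σ_k min(-4 cos p₁ cos p₂, 0)`. [cite: LiebLoss1993, §8, Theorem 8.2] -/
theorem re_expect_oneSpinDiagHop_mem (hL : 3 ≤ L) (σ : Fin 2) {ψ : Fock (Orb (FermionTorus 2 L))}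
    (h1 : star ψ ⬝ᵥ ψ = 1) :
    (∑ k : TorusSite 2 L,
        min (-(-1 : ℝ) * (4 * Real.cos (latticeMomentum L k 0) * Real.cos (latticeMomentum L k 1))) 0) ≤
      (expect (hopOp (fermionTorusDiagGraph L) σ) ψ).re ∧
    (expect (hopOp (fermionTorusDiagGraph L) σ) ψ).re ≤
      -(∑ k : TorusSite 2 L,
        min (-(1 : ℝ) * (4 * Real.cos (latticeMomentum L k 0) * Real.cos (latticeMomentum L k 1))) 0) := by
  have hnorm : normSq ψ = 1 := by
    have h := star_dotProduct_self_eq_normSq ψ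
    rw [h1] at h
    exact_mod_cast h.symm
  have hm := sum_min_diagBand_mul_normSq_le_re_oneSpin hL (-1) σ ψ
  have hp := sum_min_diagBand_mul_normSq_le_re_oneSpin hL 1 σ ψ
  rw [hnorm, mul_one, Matrix.smul_mulVec, dotProduct_smul, smul_eq_mul, Complex.re_ofReal_mul] at hm hp
  rw [expect]
  constructor
  · simpa using hm
  · have : (-(1 : ℝ)) * (star ψ ⬝ᵥ (hopOp (fermionTorusDiagGraph L) σ *ᵥ ψ)).re =
        -(star ψ ⬝ᵥ (hopOp (fermionTorusDiagGraph L) σ *ᵥ ψ)).re := by ring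
    rw [this] at hp
    linarith

end FiniteTorus

/-! ### §3 Torus limits: `|Re ω(E'_σ)| ≤ 8/π²`, and the letter form `|v_σ| ≤ 2/π²` -/

namespace InfVolFermionState

/-- **ONE-SPIN DIAGONAL-HOP KINEMATIC ROW, two-sided.** If `ω` is the torus limit along `Ls → ∞` of UNIT vectors
`ψ_j` (no particle-number, sector or ground-state hypothesis), then for each spin `σ`:
`-8/π² ≤ Re ω(E'_σ) ≤ 8/π²` — the spin-`σ` diagonal hopping density per site lies in the range of the one-species
diagonal band filled to its `μ = 0` Fermi sea. [cite: LiebLoss1993, §8, Theorem 8.2] [cite: BratteliRobinsonII1997, §6.2.4] -/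
theorem IsTorusLimitOf.re_expect_oneSpinDiagBondObs_mem {ω : InfVolFermionState 2}
    {ψ : ∀ L, Fock (Orb (FermionTorus 2 L))} {Ls : ℕ → ℕ}
    (h : ω.IsTorusLimitOf ψ Ls) (hLs : Tendsto Ls atTop atTop) (h1 : ∀ j, star (ψ (Ls j)) ⬝ᵥ ψ (Ls j) = 1)
    (σ : Fin 2) :
    -(8 / Real.pi ^ 2) ≤ (ω.expect (thicken ({0} : Finset (Site 2)) 1) (oneSpinDiagBondObs σ)).re ∧
      (ω.expect (thicken ({0} : Finset (Site 2)) 1) (oneSpinDiagBondObs σ)).re ≤ 8 / Real.pi ^ 2 := by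
  have hc := (Complex.continuous_re.tendsto _).comp (h (thicken ({0} : Finset (Site 2)) 1) (oneSpinDiagBondObs σ))
  have hX : Tendsto (fun j => (QuantumLattice.expect (hopOp (fermionTorusDiagGraph (Ls j)) σ) (ψ (Ls j))).re /
      ((Ls j : ℕ) : ℝ) ^ 2)
      atTop (𝓝 ((ω.expect (thicken ({0} : Finset (Site 2)) 1) (oneSpinDiagBondObs σ)).re)) := by
    refine hc.congr' ?_
    filter_upwards [hLs.eventually_ge_atTop 3] with j hj
    rw [Function.comp_apply, torusAvgExpect_oneSpinDiagBondObs σ hj, ← Complex.ofReal_natCast, ← Complex.ofReal_pow,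
      Complex.div_ofReal_re]
  have hlo := tendsto_cornerRiemannSum_diagBand (-1) (by norm_num) hLs
  have hhi := (tendsto_cornerRiemannSum_diagBand 1 (by norm_num) hLs).neg
  rw [neg_neg] at hhi
  constructor
  · refine le_of_tendsto_of_tendsto hlo hX ?_
    filter_upwards [hLs.eventually_ge_atTop 3] with j hj
    haveI : NeZero (Ls j) := ⟨by omega⟩
    have hL2 : (0 : ℝ) < ((Ls j : ℕ) : ℝ) ^ 2 := by
      have hLpos : (0 : ℝ) < ((Ls j : ℕ) : ℝ) := by exact_mod_cast (show 0 < Ls j by omega)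
      positivity
    have hb := (re_expect_oneSpinDiagHop_mem hj σ (h1 j)).1
    rw [← sum_min_diagBand_div_sq_eq (-1)]
    exact div_le_div_of_nonneg_right hb hL2.le
  · refine le_of_tendsto_of_tendsto hX hhi ?_
    filter_upwards [hLs.eventually_ge_atTop 3] with j hj
    haveI : NeZero (Ls j) := ⟨by omega⟩
    have hL2 : (0 : ℝ) < ((Ls j : ℕ) : ℝ) ^ 2 := by
      have hLpos : (0 : ℝ) < ((Ls j : ℕ) : ℝ) := by exact_mod_cast (show 0 < Ls j by omega)
      positivity
    have hb := (re_expect_oneSpinDiagHop_mem hj σ (h1 j)).2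
    rw [← sum_min_diagBand_div_sq_eq 1, ← neg_div]
    exact div_le_div_of_nonneg_right hb hL2.le

/-- **`|Re ω(E'_σ)| ≤ 8/π²`** for every torus limit of unit vectors and each spin. [cite: LiebLoss1993, §8, Theorem 8.2] -/
theorem IsTorusLimitOf.abs_re_expect_oneSpinDiagBondObs_le {ω : InfVolFermionState 2}
    {ψ : ∀ L, Fock (Orb (FermionTorus 2 L))} {Ls : ℕ → ℕ}
    (h : ω.IsTorusLimitOf ψ Ls) (hLs : Tendsto Ls atTop atTop) (h1 : ∀ j, star (ψ (Ls j)) ⬝ᵥ ψ (Ls j) = 1)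
    (σ : Fin 2) :
    |(ω.expect (thicken ({0} : Finset (Site 2)) 1) (oneSpinDiagBondObs σ)).re| ≤ 8 / Real.pi ^ 2 :=
  abs_le.2 (h.re_expect_oneSpinDiagBondObs_mem hLs h1 σ)

/-- The engine's outward decimal: `|Re ω(E'_σ)| ≤ 0.8105695`. [cite: LiebLoss1993, §8, Theorem 8.2] -/
theorem IsTorusLimitOf.abs_re_expect_oneSpinDiagBondObs_le_decimal {ω : InfVolFermionState 2}
    {ψ : ∀ L, Fock (Orb (FermionTorus 2 L))} {Ls : ℕ → ℕ}
    (h : ω.IsTorusLimitOf ψ Ls) (hLs : Tendsto Ls atTop atTop) (h1 : ∀ j, star (ψ (Ls j)) ⬝ᵥ ψ (Ls j) = 1)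
    (σ : Fin 2) :
    |(ω.expect (thicken ({0} : Finset (Site 2)) 1) (oneSpinDiagBondObs σ)).re| ≤ (0.8105695 : ℝ) :=
  (h.abs_re_expect_oneSpinDiagBondObs_le hLs h1 σ).trans eight_div_pi_sq_lt_decimal.le

/-- **THE LETTER FORM (T′-BOX rung (1′)).** With `v_σ := Re ω(E'_σ) / 4` — for a translation-invariant `ω` this is
the `D₄`-averaged one-spin diagonal-bond correlator `⟨c†_{0σ} c_{x̂+ŷ,σ}⟩_G`, the coverage readers' letter `v25` /
`v116` — every torus limit of unit vectors has `|v_σ| ≤ 2/π²`, `|v_σ| ≤ 0.2026424`, and in particular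
`|v_σ| ≤ 2027/10000` and `|v_σ| ≤ 79/250` (the runbook literals `h♯` / `h` of the per-letter `--ext 25:-h:h --ext 116:-h:h`
re-read; `8h♯ = 1.6216`, `8h = 2.528` replace `B_T' = 8`). [cite: LiebLoss1993, §8, Theorem 8.2] -/
theorem IsTorusLimitOf.abs_oneSpinDiagBondLetter_le {ω : InfVolFermionState 2}
    {ψ : ∀ L, Fock (Orb (FermionTorus 2 L))} {Ls : ℕ → ℕ}
    (h : ω.IsTorusLimitOf ψ Ls) (hLs : Tendsto Ls atTop atTop) (h1 : ∀ j, star (ψ (Ls j)) ⬝ᵥ ψ (Ls j) = 1)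
    (σ : Fin 2) :
    |(ω.expect (thicken ({0} : Finset (Site 2)) 1) (oneSpinDiagBondObs σ)).re / 4| ≤ 2 / Real.pi ^ 2 ∧
      |(ω.expect (thicken ({0} : Finset (Site 2)) 1) (oneSpinDiagBondObs σ)).re / 4| ≤ (0.2026424 : ℝ) ∧
      |(ω.expect (thicken ({0} : Finset (Site 2)) 1) (oneSpinDiagBondObs σ)).re / 4| ≤ (2027 / 10000 : ℝ) ∧
      |(ω.expect (thicken ({0} : Finset (Site 2)) 1) (oneSpinDiagBondObs σ)).re / 4| ≤ (79 / 250 : ℝ) := by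
  have ha := h.abs_re_expect_oneSpinDiagBondObs_le hLs h1 σ
  have hd := eight_div_pi_sq_lt_decimal
  rw [abs_div, abs_of_pos (by norm_num : (0 : ℝ) < 4)]
  refine ⟨?_, ?_, ?_, ?_⟩
  · rw [div_le_iff₀ (by norm_num : (0 : ℝ) < 4)]
    have : 2 / Real.pi ^ 2 * 4 = 8 / Real.pi ^ 2 := by ring
    rw [this]
    exact ha
  · rw [div_le_iff₀ (by norm_num : (0 : ℝ) < 4)]
    linarith
  · rw [div_le_iff₀ (by norm_num : (0 : ℝ) < 4)]
    linarith
  · rw [div_le_iff₀ (by norm_num : (0 : ℝ) < 4)]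
    linarith

/-! #### §4 (appended) The two-point (bond) form of the row — the typists' dictionary

`Re ω(E'_σ)` is the sum of the real parts of the four one-spin diagonal two-point functions at the origin,
`Σ_{δ ∈ {±(e₁+e₂), ±(e₁-e₂)}} Re ω(c†_{0σ} c_{δσ})` (only the Hermiticity `ω(Aᴴ) = conj ω(A)` of a state and the isotony
compatibility enter — no translation invariance); hence the four-bond sum lies in `[-8/π², 8/π²]` and its MEAN (the
`C₄`/`D₄`-average of the bond `⟨c†_{0σ} c_{x̂+ŷ,σ}⟩` — the rotation orbit of `x̂+ŷ` is all four diagonal vectors) obeys the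
letter bounds `≤ 2/π² ≤ 2027/10000 ≤ 79/250`. Node typists match their letter monomial to `twoPointDiag σ s b` below with
`InfVolFermionState.expect_fermionEmbed_incl_eq` / `cAt_congr`. -/

/-- The one-spin diagonal two-point observable `c†_{0σ} c_{±j_s, σ}` on its own pair region (`b = true`: `+j_s` on
`{0, 0 + j_s}`; `b = false`: `-j_s` on `{-j_s, -j_s + j_s}`), exactly the factors of `oneSpinDiagBondObs`. [folklore] -/
def twoPointDiag (σ : Fin 2) (s : Fin 2) : Bool → Σ Λ : Finset (Site 2), FermionOp Λ
  | true => ⟨{0, 0 + diagVec s},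
      (cAt (0 : Site 2) (mem_insert_self _ _) σ)ᴴ * cAt ((0 : Site 2) + diagVec s) (mem_insert_of_mem (mem_singleton_self _)) σ⟩
  | false => ⟨{-diagVec s, -diagVec s + diagVec s},
      (cAt (-diagVec s + diagVec s) (mem_insert_of_mem (mem_singleton_self _)) σ)ᴴ * cAt (-diagVec s) (mem_insert_self _ _) σ⟩

/-- **Bond form of `Re ω(E'_σ)`**: for EVERY infinite-volume state `ω` and each spin `σ`,
`Re ω(E'_σ) = Σ_s (Re ω(c†_{0σ} c_{j_s σ}) + Re ω(c†_{0σ} c_{-j_s σ}))` (each two-point function read on its pair region).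
[cite: BratteliRobinsonI1987, §2.3.2] -/
theorem re_expect_oneSpinDiagBondObs_eq_sum_twoPoint (ω : InfVolFermionState 2) (σ : Fin 2) :
    (ω.expect (thicken ({0} : Finset (Site 2)) 1) (oneSpinDiagBondObs σ)).re =
      ∑ s : Fin 2, ((ω.expect (twoPointDiag σ s true).1 (twoPointDiag σ s true).2).re +
        (ω.expect (twoPointDiag σ s false).1 (twoPointDiag σ s false).2).re) := by
  rw [oneSpinDiagBondObs, map_sum, Complex.re_sum]
  refine Finset.sum_congr rfl fun s _ => ?_
  have hadj₁ : (cAt ((0 : Site 2) + diagVec s) (mem_insert_of_mem (mem_singleton_self _)) σ)ᴴ *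
        cAt (0 : Site 2) (mem_insert_self _ ({(0 : Site 2) + diagVec s} : Finset (Site 2))) σ =
      ((cAt (0 : Site 2) (mem_insert_self _ _) σ)ᴴ *
        cAt ((0 : Site 2) + diagVec s) (mem_insert_of_mem (mem_singleton_self _)) σ)ᴴ := by
    rw [Matrix.conjTranspose_mul, Matrix.conjTranspose_conjTranspose]
  have hadj₂ : (cAt (-diagVec s) (mem_insert_self _ ({-diagVec s + diagVec s} : Finset (Site 2))) σ)ᴴ *
        cAt (-diagVec s + diagVec s) (mem_insert_of_mem (mem_singleton_self _)) σ =
      ((cAt (-diagVec s + diagVec s) (mem_insert_of_mem (mem_singleton_self _)) σ)ᴴ *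
        cAt (-diagVec s) (mem_insert_self _ _) σ)ᴴ := by
    rw [Matrix.conjTranspose_mul, Matrix.conjTranspose_conjTranspose]
  rw [map_add, map_smul, map_smul, ω.compatible, ω.compatible, map_add, map_add, hadj₁, hadj₂,
    ω.expect_conjTranspose, ω.expect_conjTranspose]
  simp only [twoPointDiag]
  set z := ω.expect ({0, 0 + diagVec s} : Finset (Site 2))
      ((cAt (0 : Site 2) (mem_insert_self _ _) σ)ᴴ *
        cAt ((0 : Site 2) + diagVec s) (mem_insert_of_mem (mem_singleton_self _)) σ) with hz
  set w := ω.expect ({-diagVec s, -diagVec s + diagVec s} : Finset (Site 2))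
      ((cAt (-diagVec s + diagVec s) (mem_insert_of_mem (mem_singleton_self _)) σ)ᴴ *
        cAt (-diagVec s) (mem_insert_self _ _) σ) with hw
  have key₁ : ∀ u : ℂ, ((2 : ℂ)⁻¹ • (u + star u)).re = u.re := by
    intro u
    simp only [smul_eq_mul, Complex.mul_re, Complex.add_re, Complex.add_im, Complex.star_def, Complex.conj_re,
      Complex.conj_im, Complex.inv_re, Complex.inv_im]
    norm_num
    ring
  have key₂ : ∀ u : ℂ, ((2 : ℂ)⁻¹ • (star u + u)).re = u.re := by
    intro u
    rw [add_comm]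
    exact key₁ u
  rw [Complex.add_re, key₁ z, key₂ w]
  rfl

/-- **The four-bond sum and its mean, bounded for every torus limit of unit vectors**:
`|Σ_s (Re ω(c†_{0σ}c_{j_sσ}) + Re ω(c†_{0σ}c_{-j_sσ}))| ≤ 8/π²`, and the MEAN over the four diagonal bonds (the reader's letter
`v25` / `v116` when its `G` contains the rotations) is `≤ 2/π²`, `≤ 2027/10000`, `≤ 79/250` in absolute value.
[cite: LiebLoss1993, §8, Theorem 8.2] -/
theorem IsTorusLimitOf.abs_sum_twoPointDiag_le {ω : InfVolFermionState 2}
    {ψ : ∀ L, Fock (Orb (FermionTorus 2 L))} {Ls : ℕ → ℕ}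
    (h : ω.IsTorusLimitOf ψ Ls) (hLs : Tendsto Ls atTop atTop) (h1 : ∀ j, star (ψ (Ls j)) ⬝ᵥ ψ (Ls j) = 1)
    (σ : Fin 2) :
    |∑ s : Fin 2, ((ω.expect (twoPointDiag σ s true).1 (twoPointDiag σ s true).2).re +
        (ω.expect (twoPointDiag σ s false).1 (twoPointDiag σ s false).2).re)| ≤ 8 / Real.pi ^ 2 ∧
      |(∑ s : Fin 2, ((ω.expect (twoPointDiag σ s true).1 (twoPointDiag σ s true).2).re +
        (ω.expect (twoPointDiag σ s false).1 (twoPointDiag σ s false).2).re)) / 4| ≤ 2 / Real.pi ^ 2 ∧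
      |(∑ s : Fin 2, ((ω.expect (twoPointDiag σ s true).1 (twoPointDiag σ s true).2).re +
        (ω.expect (twoPointDiag σ s false).1 (twoPointDiag σ s false).2).re)) / 4| ≤ (2027 / 10000 : ℝ) ∧
      |(∑ s : Fin 2, ((ω.expect (twoPointDiag σ s true).1 (twoPointDiag σ s true).2).re +
        (ω.expect (twoPointDiag σ s false).1 (twoPointDiag σ s false).2).re)) / 4| ≤ (79 / 250 : ℝ) := by
  rw [← re_expect_oneSpinDiagBondObs_eq_sum_twoPoint ω σ]
  have hL := h.abs_oneSpinDiagBondLetter_le hLs h1 σ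
  exact ⟨h.abs_re_expect_oneSpinDiagBondObs_le hLs h1 σ, hL.1, hL.2.2.1, hL.2.2.2⟩

end InfVolFermionState

end Literature.MathematicalPhysics.QuantumLattice

end
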